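import Literature.MathematicalPhysics.QuantumFieldTheory.Balaban1983to89.B15Prop1Minimum

/-!
# `Balaban1983to89.B15Prop1MinimumBall` — [Balaban1989LargeFieldI] Prop. 1 p. 194 *«An element of the orbit is a minimum of the
# function»* / [Balaban1989LargeFieldII] p. 359: r13∕n12-b's minimum and uniqueness lemmas of the abstract p. 359 model WITH THE
# FIRST-VARIATION LETTER ASKED ONLY ON THE BALL `‖X‖ ≤ r` (print: *«V′ satisfies mild regularity conditions … we can write V′ = exp iB′.
# We expand the function with respect to B′»* — an expansion for SMALL `B′`, not a global one)

statement-level skeleton of published theorems with citation tags; proofs where landed; nothing here is a claim about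
the Yang–Mills mass gap

Cell pub-ymgap, HUMAN RULING D-0062 (Track A full width), seat `pub-ymgap-dag-n12-c` (R134 acceleration seat (a), strategy s1 of DAG node
N12 = [B15]; generation g4, fifth product; SELF-AUDIT TS-LETTERS-GLOBAL of the N12∕s1 chain, pub-ymgap INBOX 2026-08-27 ≈04:09Z).

WHY.  `B15Prop1Minimum.lt_of_critical_of_ne` ∕ `le_of_critical` (r12∕r13 block) and `B15Prop1FromModel.critical_unique_of_chart` (n12-b)
take the first-variation letter `hA : ∀ X δ, HasDerivAt (s ↦ A(X + sδ)) (…) 0` at EVERY configuration `X` of the coordinate space; their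
proofs use it only on the gauge segment from `B` to `B′` inside the ball `‖·‖ ≤ r` (where Proposition 4 [15] controls `(δ/δA)V`).  At
print's instance `A = B′ ↦ A(U_{k,Z}(exp(iB′)Ṽ_k))` is the expansion of p. 359, available for small `B′` only; the global letter is
stronger than print and — combined with the contraction letters — not satisfiable by a junk extension.  THIS FILE re-proves the three
lemmas with `hA` asked only for `‖X‖ ≤ r` (identical mathematics; `B15Prop1Minimum.firstVariation_diff_eq` ∕ `firstVariation_lower_bound`
BY NAME), for the re-threaded N12∕s1 chain with LOCAL letters.

WHAT THIS FILE PROVES (no `sorry`, no definition, no `… : Prop` fact; axioms standard): `hasDerivAt_rebase` (re-basing a first variation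
along a line), ★ `lt_of_critical_of_ne_ball`, ★ `le_of_critical_ball`, ★ `critical_unique_of_chart_ball` — the statements of the originals
with `hA : ∀ X δ, ‖X‖ ≤ r → HasDerivAt (fun s => A (X + s • δ)) (…) 0`; and ★ `eq_zero_of_flat_firstVariation` — the kernel form of the
located point: the letters (positivity, `dV 0 = 0`, Lipschitz, smallness) admit NO flat first variation on a gauge ball containing a non-zero
vector, so they cannot be met where print's function is replaced by a constant (junk) extension.

HONEST SCOPE.  Abstract model; nothing of Proposition 1 asserted; count-neutral; NOT a discharge of N12; nothing continuum ∕ OS ∕ mass-gap ∕ Clay.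
-/

namespace Literature.MathematicalPhysics.QuantumFieldTheory.Balaban1983to89.B15Prop1MinimumBall

open scoped RealInnerProductSpace
open Set B15Prop1Minimum

variable {E F : Type*} [NormedAddCommGroup E] [InnerProductSpace ℝ E]
  [NormedAddCommGroup F] [InnerProductSpace ℝ F]

/-- Re-basing a first variation: from the derivative of `s ↦ A(X′ + sδ)` at `0` for `X′ = X + tδ`, the derivative of `s ↦ A(X + sδ)` at `t`.
[cite: Balaban1989LargeFieldII, p.359 («We expand the function with respect to B′»)] -/
theorem hasDerivAt_rebase {A : E → ℝ} {X δ : E} {t d : ℝ} (h : HasDerivAt (fun s : ℝ => A ((X + t • δ) + s • δ)) d 0) :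
    HasDerivAt (fun s : ℝ => A (X + s • δ)) d t := by
  have h0 : HasDerivAt (fun s : ℝ => A ((X + t • δ) + s • δ)) d (t - t) := by rw [sub_self]; exact h
  have h1 : HasDerivAt (fun s : ℝ => A ((X + t • δ) + (s - t) • δ)) d t := h0.comp_sub_const t t
  have heq : (fun s : ℝ => A (X + s • δ)) = fun s : ℝ => A ((X + t • δ) + (s - t) • δ) := by
    funext s
    congr 1
    rw [sub_smul]; abel
  rw [heq]
  exact h1

/-- **The minimum clause, strict form, with the first variation asked only on the ball** — `B15Prop1Minimum.lt_of_critical_of_ne` with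
`hA : ∀ X δ, ‖X‖ ≤ r → …`: a (1.12)-critical gauge-fixed `B` of the ball `‖·‖ ≤ r` (`h₁r ≤ ρ`) has `A B < A B′` for every other gauge-fixed
`B′` of the ball (the gauge segment stays in the ball, where `hA` is available). [cite: Balaban1989LargeFieldI, Prop. 1 p.194 («An element
of the orbit is a minimum of the function»); Balaban1989LargeFieldII, p.359, (1.9) p.358; Balaban1985Variational, Prop. 4 p.293] -/
theorem lt_of_critical_of_ne_ball {P₀ : E →ₗ[ℝ] E} (H : E →ₗ[ℝ] F) (Hst : F →ₗ[ℝ] E)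
    (hadj : ∀ (x : E) (y : F), ⟪H x, y⟫ = ⟪x, Hst y⟫) (Δ₁ : F →ₗ[ℝ] F) (dV : F → F) (J : F)
    {A : E → ℝ} {r : ℝ}
    (hA : ∀ X δ : E, ‖X‖ ≤ r → HasDerivAt (fun s : ℝ => A (X + s • δ))
      (⟪δ, Hst J⟫ + ⟪δ, Hst (Δ₁ (H X))⟫ + ⟪δ, Hst (dV (H X))⟫) 0)
    {c : ℝ} (hc : 0 < c) (hpos : ∀ x, P₀ x = x → c * ‖x‖ ^ 2 ≤ ⟪H x, Δ₁ (H x)⟫)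
    {h₁ hst ℓ ρ : ℝ} (hh₁ : 0 ≤ h₁) (hhst : 0 ≤ hst) (hℓ : 0 ≤ ℓ)
    (hH : ∀ x : E, ‖H x‖ ≤ h₁ * ‖x‖) (hHst : ∀ z : F, ‖Hst z‖ ≤ hst * ‖z‖)
    (hdV : ∀ u v : F, ‖u‖ ≤ ρ → ‖v‖ ≤ ρ → ‖dV u - dV v‖ ≤ ℓ * ‖u - v‖) (hρ : h₁ * r ≤ ρ)
    (hsmall : c⁻¹ * hst * ℓ * h₁ ≤ 1 / 2) {B : E} (hBg : P₀ B = B) (hBn : ‖B‖ ≤ r)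
    (hcrit : ∀ δB : E, P₀ δB = δB →
      ⟪δB, Hst J⟫ + ⟪δB, Hst (Δ₁ (H B))⟫ + ⟪δB, Hst (dV (H B))⟫ = 0)
    {B' : E} (hB'g : P₀ B' = B') (hB'n : ‖B'‖ ≤ r) (hne : B' ≠ B) : A B < A B' := by
  set v : E := B' - B with hv
  have hvg : P₀ v = v := by rw [hv, map_sub, hBg, hB'g]
  have hvn : 0 < ‖v‖ := norm_pos_iff.mpr (sub_ne_zero.mpr hne)
  set φ : ℝ → ℝ := fun s => A (B + s • v) with hφ
  -- the segment stays in the ball of radius r, its H-image in the ball of radius ρ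
  have hseg : ∀ t : ℝ, 0 ≤ t → t ≤ 1 → ‖B + t • v‖ ≤ r := by
    intro t ht0 ht1
    have hrepr : B + t • v = (1 - t) • B + t • B' := by
      rw [hv, smul_sub, sub_smul, one_smul]; abel
    rw [hrepr]
    calc ‖(1 - t) • B + t • B'‖ ≤ ‖(1 - t) • B‖ + ‖t • B'‖ := norm_add_le _ _
      _ = (1 - t) * ‖B‖ + t * ‖B'‖ := by
          rw [norm_smul, norm_smul, Real.norm_eq_abs, Real.norm_eq_abs, abs_of_nonneg (by linarith),
            abs_of_nonneg ht0]
      _ ≤ (1 - t) * r + t * r :=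
          add_le_add (mul_le_mul_of_nonneg_left hBn (by linarith)) (mul_le_mul_of_nonneg_left hB'n ht0)
      _ = r := by ring
  -- the derivative of φ at every parameter of the segment (the only place `hA` is used: ON THE BALL)
  have hder : ∀ t : ℝ, 0 ≤ t → t ≤ 1 → HasDerivAt φ
      (⟪v, Hst J⟫ + ⟪v, Hst (Δ₁ (H (B + t • v)))⟫ + ⟪v, Hst (dV (H (B + t • v)))⟫) t :=
    fun t ht0 ht1 => hasDerivAt_rebase (hA (B + t • v) v (hseg t ht0 ht1))
  have hcont : ContinuousOn φ (Icc 0 1) := fun t ht => (hder t ht.1 ht.2).continuousAt.continuousWithinAt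
  have hHρ : ∀ X : E, ‖X‖ ≤ r → ‖H X‖ ≤ ρ := fun X hX =>
    (hH X).trans ((mul_le_mul_of_nonneg_left hX hh₁).trans hρ)
  -- the derivative is positive inside the segment
  have hpos' : ∀ t ∈ interior (Icc (0 : ℝ) 1), 0 < deriv φ t := by
    intro t ht
    rw [interior_Icc] at ht
    obtain ⟨ht0, ht1⟩ := ht
    rw [(hder t ht0.le ht1.le).deriv]
    have hdiff := firstVariation_diff_eq H Hst hadj Δ₁ dV J B v t
    rw [hcrit v hvg, sub_zero] at hdiff
    rw [hdiff]
    have hlow := firstVariation_lower_bound H Hst hadj Δ₁ dV hc hpos hhst hℓ hH hHst hdV hsmall hvg ht0.le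
      (hHρ _ (hseg t ht0.le ht1.le)) (hHρ _ hBn)
    have hmargin : 0 < t * (c / 2) * ‖v‖ ^ 2 := mul_pos (mul_pos ht0 (half_pos hc)) (pow_pos hvn 2)
    linarith
  have hmono : StrictMonoOn φ (Icc 0 1) := strictMonoOn_of_deriv_pos (convex_Icc 0 1) hcont hpos'
  have h01 : φ 0 < φ 1 :=
    hmono (left_mem_Icc.mpr zero_le_one) (right_mem_Icc.mpr zero_le_one) zero_lt_one
  have hφ0 : φ 0 = A B := by simp [hφ]
  have hφ1 : φ 1 = A B' := by
    simp only [hφ, one_smul, hv]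
    congr 1; abel
  rwa [hφ0, hφ1] at h01

/-- **The minimum clause, non-strict form, `hA` on the ball** (`B15Prop1Minimum.le_of_critical` localized). [cite: Balaban1989LargeFieldI,
Prop. 1 p.194; Balaban1989LargeFieldII, p.359] -/
theorem le_of_critical_ball {P₀ : E →ₗ[ℝ] E} (H : E →ₗ[ℝ] F) (Hst : F →ₗ[ℝ] E)
    (hadj : ∀ (x : E) (y : F), ⟪H x, y⟫ = ⟪x, Hst y⟫) (Δ₁ : F →ₗ[ℝ] F) (dV : F → F) (J : F)
    {A : E → ℝ} {r : ℝ}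
    (hA : ∀ X δ : E, ‖X‖ ≤ r → HasDerivAt (fun s : ℝ => A (X + s • δ))
      (⟪δ, Hst J⟫ + ⟪δ, Hst (Δ₁ (H X))⟫ + ⟪δ, Hst (dV (H X))⟫) 0)
    {c : ℝ} (hc : 0 < c) (hpos : ∀ x, P₀ x = x → c * ‖x‖ ^ 2 ≤ ⟪H x, Δ₁ (H x)⟫)
    {h₁ hst ℓ ρ : ℝ} (hh₁ : 0 ≤ h₁) (hhst : 0 ≤ hst) (hℓ : 0 ≤ ℓ)
    (hH : ∀ x : E, ‖H x‖ ≤ h₁ * ‖x‖) (hHst : ∀ z : F, ‖Hst z‖ ≤ hst * ‖z‖)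
    (hdV : ∀ u v : F, ‖u‖ ≤ ρ → ‖v‖ ≤ ρ → ‖dV u - dV v‖ ≤ ℓ * ‖u - v‖) (hρ : h₁ * r ≤ ρ)
    (hsmall : c⁻¹ * hst * ℓ * h₁ ≤ 1 / 2) {B : E} (hBg : P₀ B = B) (hBn : ‖B‖ ≤ r)
    (hcrit : ∀ δB : E, P₀ δB = δB →
      ⟪δB, Hst J⟫ + ⟪δB, Hst (Δ₁ (H B))⟫ + ⟪δB, Hst (dV (H B))⟫ = 0)
    {B' : E} (hB'g : P₀ B' = B') (hB'n : ‖B'‖ ≤ r) : A B ≤ A B' := by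
  by_cases hne : B' = B
  · rw [hne]
  · exact (lt_of_critical_of_ne_ball H Hst hadj Δ₁ dV J hA hc hpos hh₁ hhst hℓ hH hHst hdV hρ hsmall hBg hBn hcrit
      hB'g hB'n hne).le

/-- **Uniqueness of the (1.12)-critical configuration in the gauge ball, `hA` on the ball** (`B15Prop1FromModel.critical_unique_of_chart`
localized): two (1.12)-critical gauge-fixed configurations of the ball coincide (each would be strictly below the other).
[cite: Balaban1989LargeFieldI, Prop. 1 p.194 («exactly one critical orbit»); Balaban1989LargeFieldII, p.359] -/
theorem critical_unique_of_chart_ball {P₀ : E →ₗ[ℝ] E} (H : E →ₗ[ℝ] F) (Hst : F →ₗ[ℝ] E)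
    (hadj : ∀ (x : E) (y : F), ⟪H x, y⟫ = ⟪x, Hst y⟫) (Δ₁ : F →ₗ[ℝ] F) (dV : F → F) (J : F)
    {A : E → ℝ} {r : ℝ}
    (hA : ∀ X δ : E, ‖X‖ ≤ r → HasDerivAt (fun s : ℝ => A (X + s • δ))
      (⟪δ, Hst J⟫ + ⟪δ, Hst (Δ₁ (H X))⟫ + ⟪δ, Hst (dV (H X))⟫) 0)
    {c : ℝ} (hc : 0 < c) (hpos : ∀ x, P₀ x = x → c * ‖x‖ ^ 2 ≤ ⟪H x, Δ₁ (H x)⟫)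
    {h₁ hst ℓ ρ : ℝ} (hh₁ : 0 ≤ h₁) (hhst : 0 ≤ hst) (hℓ : 0 ≤ ℓ)
    (hH : ∀ x : E, ‖H x‖ ≤ h₁ * ‖x‖) (hHst : ∀ z : F, ‖Hst z‖ ≤ hst * ‖z‖)
    (hdV : ∀ u v : F, ‖u‖ ≤ ρ → ‖v‖ ≤ ρ → ‖dV u - dV v‖ ≤ ℓ * ‖u - v‖) (hρ : h₁ * r ≤ ρ)
    (hsmall : c⁻¹ * hst * ℓ * h₁ ≤ 1 / 2) {B : E} (hBg : P₀ B = B) (hBn : ‖B‖ ≤ r)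
    (hcrit : ∀ δB : E, P₀ δB = δB →
      ⟪δB, Hst J⟫ + ⟪δB, Hst (Δ₁ (H B))⟫ + ⟪δB, Hst (dV (H B))⟫ = 0)
    {B' : E} (hB'g : P₀ B' = B') (hB'n : ‖B'‖ ≤ r)
    (hcrit' : ∀ δB : E, P₀ δB = δB →
      ⟪δB, Hst J⟫ + ⟪δB, Hst (Δ₁ (H B'))⟫ + ⟪δB, Hst (dV (H B'))⟫ = 0) : B' = B := by
  by_contra hne
  have h1 : A B < A B' :=
    lt_of_critical_of_ne_ball H Hst hadj Δ₁ dV J hA hc hpos hh₁ hhst hℓ hH hHst hdV hρ hsmall hBg hBn hcrit hB'g hB'n hne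
  have h2 : A B' < A B :=
    lt_of_critical_of_ne_ball H Hst hadj Δ₁ dV J hA hc hpos hh₁ hhst hℓ hH hHst hdV hρ hsmall hB'g hB'n hcrit' hBg hBn
      (Ne.symm hne)
  exact lt_asymm h1 h2

/-- **THE LETTERS OF THE p. 359 MODEL ARE INCOMPATIBLE WITH A FLAT FUNCTION ON THE GAUGE BALL** (kernel form of the located typing-strength
point, SELF-AUDIT TS-LETTERS-GLOBAL): if the displayed first variation `⟨δ, H*J⟩ + ⟨δ, H*Δ₁HX⟩ + ⟨δ, H*(δ/δA)V(HX)⟩` VANISHES identically for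
`‖X‖ ≤ r` (as it must where `A` is constant — e.g. a junk extension of the minimiser), then the positivity (1.9), `(δ/δA)V(0) = 0`, the Lipschitz
letter of Proposition 4 [15] on the ball of radius `ρ ≥ h₁r` and the contraction smallness `c⁻¹·hst·ℓ·h₁ ≤ ½` leave NO non-zero gauge-fixed `X`
in the ball: at `X` the identity gives `⟨HX, Δ₁HX⟩ = −⟨HX, dV(HX) − dV(0)⟩ ≤ hst·ℓ·h₁‖X‖² ≤ (c/2)‖X‖²` against `c‖X‖² ≤ ⟨HX, Δ₁HX⟩`.  So the
GLOBAL letters of the landed chain cannot be met at boundary data ∕ chart points where print's function is replaced by a constant.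
[cite: Balaban1989LargeFieldII, p.359 («By the inequality (1.9) the operator P₀H*_{1,k}Δ₁H_{1,k}P₀ is positive», «Using Proposition 4 [15]»);
Balaban1985Variational, Prop. 4 p.293] -/
theorem eq_zero_of_flat_firstVariation {P₀ : E →ₗ[ℝ] E} (H : E →ₗ[ℝ] F) (Hst : F →ₗ[ℝ] E)
    (hadj : ∀ (x : E) (y : F), ⟪H x, y⟫ = ⟪x, Hst y⟫) (Δ₁ : F →ₗ[ℝ] F) (dV : F → F) (J : F) {r : ℝ}
    (hflat : ∀ X δ : E, ‖X‖ ≤ r → ⟪δ, Hst J⟫ + ⟪δ, Hst (Δ₁ (H X))⟫ + ⟪δ, Hst (dV (H X))⟫ = 0)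
    {c : ℝ} (hc : 0 < c) (hpos : ∀ x, P₀ x = x → c * ‖x‖ ^ 2 ≤ ⟪H x, Δ₁ (H x)⟫)
    {h₁ hst ℓ ρ : ℝ} (hh₁ : 0 ≤ h₁) (hhst : 0 ≤ hst) (hℓ : 0 ≤ ℓ)
    (hH : ∀ x : E, ‖H x‖ ≤ h₁ * ‖x‖) (hHst : ∀ z : F, ‖Hst z‖ ≤ hst * ‖z‖) (hdV0 : dV 0 = 0)
    (hdV : ∀ u v : F, ‖u‖ ≤ ρ → ‖v‖ ≤ ρ → ‖dV u - dV v‖ ≤ ℓ * ‖u - v‖) (hρ : h₁ * r ≤ ρ)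
    (hsmall : c⁻¹ * hst * ℓ * h₁ ≤ 1 / 2) {X : E} (hXg : P₀ X = X) (hXr : ‖X‖ ≤ r) : X = 0 := by
  by_contra hX0
  have hXn : 0 < ‖X‖ := norm_pos_iff.2 hX0
  have hr0 : 0 ≤ r := (norm_nonneg X).trans hXr
  have hρ0 : 0 ≤ ρ := (mul_nonneg hh₁ hr0).trans hρ
  -- the first variation at the base point `0` in the direction `X`: `⟨X, H*J⟩ = 0`
  have h0 := hflat 0 X (by rw [norm_zero]; exact hr0)
  rw [map_zero, map_zero, hdV0, map_zero, inner_zero_right, add_zero, add_zero] at h0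
  -- at `X` in the direction `X`
  have h1 := hflat X X hXr
  rw [h0, zero_add, ← hadj, ← hadj] at h1
  -- `⟨HX, Δ₁HX⟩ = −⟨HX, dV(HX) − dV 0⟩ ≤ hst·ℓ·h₁‖X‖²`
  have hHX : ‖H X‖ ≤ ρ := (hH X).trans ((mul_le_mul_of_nonneg_left hXr hh₁).trans hρ)
  have h2 : ⟪H X, Δ₁ (H X)⟫ = -⟪H X, dV (H X) - dV 0⟫ := by
    rw [hdV0, sub_zero]; linarith
  have h3 : ‖dV (H X) - dV 0‖ ≤ ℓ * ‖H X‖ := by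
    have := hdV (H X) 0 hHX (by rw [norm_zero]; exact hρ0)
    rwa [sub_zero] at this
  have hHX₁ : ‖H X‖ ≤ h₁ * ‖X‖ := hH X
  have hHX₂ : ‖H X‖ ≤ hst * ‖X‖ := norm_le_of_adjoint H Hst hadj hhst hHst X
  have h4 : ⟪H X, Δ₁ (H X)⟫ ≤ hst * ℓ * h₁ * ‖X‖ ^ 2 := by
    have h5 : |⟪H X, dV (H X) - dV 0⟫| ≤ ‖H X‖ * (ℓ * ‖H X‖) :=
      (abs_real_inner_le_norm _ _).trans (mul_le_mul_of_nonneg_left h3 (norm_nonneg _))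
    have h6 : ‖H X‖ * (ℓ * ‖H X‖) ≤ hst * ℓ * h₁ * ‖X‖ ^ 2 := by
      have hsq : ‖H X‖ * ‖H X‖ ≤ (hst * ‖X‖) * (h₁ * ‖X‖) :=
        mul_le_mul hHX₂ hHX₁ (norm_nonneg _) (mul_nonneg hhst (norm_nonneg _))
      calc ‖H X‖ * (ℓ * ‖H X‖) = ℓ * (‖H X‖ * ‖H X‖) := by ring
        _ ≤ ℓ * ((hst * ‖X‖) * (h₁ * ‖X‖)) := mul_le_mul_of_nonneg_left hsq hℓ
        _ = hst * ℓ * h₁ * ‖X‖ ^ 2 := by ring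
    have := neg_le_abs ⟪H X, dV (H X) - dV 0⟫
    rw [h2]; linarith [abs_nonneg ⟪H X, dV (H X) - dV 0⟫, le_abs_self ⟪H X, dV (H X) - dV 0⟫]
  -- against the positivity and the smallness
  have h7 : c * ‖X‖ ^ 2 ≤ hst * ℓ * h₁ * ‖X‖ ^ 2 := (hpos X hXg).trans h4
  have hsm : hst * ℓ * h₁ ≤ c / 2 := by
    have hmul := mul_le_mul_of_nonneg_left hsmall hc.le
    have hcc : c * (c⁻¹ * hst * ℓ * h₁) = hst * ℓ * h₁ := by field_simp
    linarith
  have hX2 : 0 < ‖X‖ ^ 2 := pow_pos hXn 2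
  nlinarith

end Literature.MathematicalPhysics.QuantumFieldTheory.Balaban1983to89.B15Prop1MinimumBall
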